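import Literature.MathematicalPhysics.QuantumFieldTheory.Balaban1983to89.B9Eq334GaugeCovarianceZd
import Literature.MathematicalPhysics.QuantumFieldTheory.Balaban1983to89.B9Eq327GreenZdHerm

/-!
# `Balaban1983to89.B9Eq334GaugeCovarianceZdHerm` — [Balaban1985BackgroundPropagators] (3.34) p. 396 ON THE HERMITIAN SUB-CARRIER `E_𝔤(Ω₀)` OF THE `ℤᵈ × 𝔸`
# JUNCTION (dag-n06-b's EDITION H: `domSubH ∕ RegularAtH ∕ gopZdH ∕ HermPreservingAt`, `LinearOnDomAt`): the structural inputs of the per-member Theorem-3.11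
# road — ℝ-linearity of `Δ_a(U₀)` on `E(Ω₀)`, Hermiticity-preservation, invertibility on `E_𝔤(Ω₀)`, positive-definiteness on `E_𝔤(Ω₀)` — MOVE ALONG THE GAUGE
# ORBIT, and `G_𝔤(U₀^u)(R(u)J) = R(u)G_𝔤(U₀)J`

statement-level skeleton of published theorems with citation tags; proofs where landed; nothing here is a claim about the
Yang–Mills mass gap

T. Bałaban, *Propagators for lattice gauge theories in a background field*, Commun. Math. Phys. **99** (1985) 389–434 [`Balaban1985BackgroundPropagators`,
"B9"], journal page = PDF page + 388.  THE PRINT (verbatim).  p. 396: *«Δ_a(U^u) = R(u)Δ_a(U)R(u⁻¹), G(U^u) = R(u)G(U)R(u⁻¹). (3.34)»*; p. 391: the fields are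
*«hermitian matrices»* (`𝔤`-valued); p. 416 Theorem 3.11: *«Then the operators Δ′_a, G′, (Q′G′²Q′\*)⁻¹, Δ_a, G are positive definite»*; p. 396 (3.35)–(3.36): the
regularity class is an orbit condition («there exists a gauge transformation u … such that U^u = e^{iηA}»).

CITATION HEADER ∕ WHY THIS FILE (cell `pub-ymgap`, HUMAN RULING D-0062 ∕ D-0149; width seat `pub-ymgap-dag-n06-w3` (g3), node N06 = [B9]; CLAIM-2 FILE D).
The per-member Theorem-3.11 road at the `ℤᵈ` carrier runs on the HERMITIAN sub-carrier: dag-n06-b's flat base case `B9Thm311FlatHermKernelZd.flat_posDef_herm_cube`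
(positivity of `⟨A, Δ_a(1)A⟩_τ` on `E_𝔤(□₀)`), dag-n06-w4 g3's openness engine `B9Thm311PosDefOpenZd` (eats `LinearOnDomAt` + `HermPreservingAt` on a background set,
gives `RegularAtH` ∕ `gopZdH_deltaAOf` near `U₀ = 1`).  The companion `B9Eq334GaugeCovarianceZd` transports `RegularAt ∕ gopZd ∕` positivity on `E(Ω₀)`; THIS
FILE is its `E_𝔤(Ω₀)` twin, so that «near `U₀ = 1`» becomes «near every pure gauge `1^u`» in exactly the currencies the (ii)-engine consumes.  INPUTS BY NAME:
dag-n06-b `B9Eq327GreenZdHerm` (`hermPart ∕ domSubH ∕ restrictLinH ∕ RegularAtH ∕ deltaAEquivH ∕ gopZdH ∕ HermPreservingAt`), dag-n06-w4 `B9Eq327GreenZd.LinearOnDomAt`, the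
companions' `rotB ∕ rotD ∕ LetterCovAt ∕ deltaADom_gaugeAct ∕ bondPair_rotB ∕ letterCovAt_deltaAOf_opsAllZd ∕ isSelfAdjoint_conjR`.

WHAT IS DECLARED ∕ PROVED (kernel, 0 sorry; one definition with body — `R(u)` on `E_𝔤(Ω₀)` — and theorems; no `instance`, no `notation`).  `u` unitary-valued,
`U₀` any background of units (unitary where the genuine record's `Q*aQ` enters), `τ` tracial.
* §1 `hermPart_conjR` (`herm(R(v)a) = R(v)herm(a)`, `v` unitary), `rotB_mem_domSubH` (`R(u)E_𝔤(Ω₀) ⊂ E_𝔤(Ω₀)`), `rotDH u Ω₀` (def), `coe_rotDH`, `rotDH_inv_rotDH ∕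
  rotDH_rotDH_inv`, `rotDH_bijective`, ★ `restrictLinH_rotB` (`herm∘𝟙_{Ω₀}` commutes with `R(u)`).
* §2 along the orbit, for ANY record `o` whose `Δ_a` is covariant at `(U₀, u)`: ★ `linearOnDomAt_gaugeAct`, ★ `hermPreservingAt_gaugeAct`, ★ `regularAtH_gaugeAct`,
  `regularAtH_gaugeAct_iff`, ★★★ `gopZdH_gaugeAct` (`G_𝔤(U₀^u)(R(u)J) = R(u)(G_𝔤(U₀)J)`), ★★ `posDefH_gaugeAct` (positivity on `E_𝔤(Ω₀)` passes from `U₀` to `U₀^u`).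
* §3 the genuine record `opsAllZd τ L ΛbP ops₀` (finite `Ω₀`, unitary `U₀`, `2 ≤ L`, box clause at levels `1 ≤ j` (P₀), `τ` tracial Hermitian faithful): `linearOnDomAt_opsAllZd_gaugeAct`,
  `hermPreservingAt_opsAllZd_gaugeAct`, `regularAtH_opsAllZd_gaugeAct_iff`, ★★★ `gopZdH_opsAllZd_gaugeAct`, ★★ `posDefH_opsAllZd_gaugeAct`.
* §4 the same three transports WITHOUT the box clause, for `U₀` in the class (1.7) on all of `ℤᵈ` (any class, crossing bonds allowed — the regime set of
  `B9Thm311PosDefOpenZd`'s cube corollaries): `linearOnDomAt_ ∕ hermPreservingAt_ ∕ posDefH_opsAllZd_gaugeAct_of_reg17Univ`.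

HONEST SCOPE.  Conjugation ∕ linear algebra on landed objects; no estimate of [B9]; Theorem 3.11 at curved `U₀` NOT proved (this is the transport step only);
count-neutral; N05 ∕ N06 NOT discharged; K1⁷ `stmt-QuantumFields-20542` NOT closed; one finite `𝕋⁴` programme at fixed `ε`, Bałaban as printed; R4 closes only the
conditional finite-`𝕋⁴` rung `BalabanLadder.UV` — nothing continuum ∕ ℝ⁴ ∕ OS ∕ mass gap ∕ Clay.  Unit `pub-ymgap-dag-n06-w3` (g3), 2026-08-28.
-/

noncomputable section

namespace Literature.MathematicalPhysics.QuantumFieldTheory.Balaban1983to89.B9Eq334GaugeCovarianceZdHerm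

open B7Prop1Explicit B7Eq78Linearization
open B7Prop1Local (InBox loK bondHiK)
open B7Prop2Explicit (unitaryUnits)
open B8Ineq132 (BondTouches conjR_conjR one_conjR)
open B8LeafModelZd (ZdIdx)
open B9SupplySockB9P3ZdLetters (OpsZd deltaAOf)
open B9SupplySockB9P3ZdLettersOmega (restrictDom restrictDom_of restrictDom_of_not)
open B9Eq321LandauProjectionZd (opsLandau star_conjR_of_mem_unitaryUnits)
open B9Eq327GreenZd
open B9Eq327GreenZdHerm
open B9SupplySockB9P3ZdGammaInAkDpZd (withDpZd)
open B9Eq316AveragingTransposeZdPrinted (withQQP)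
open B9SupplySockB9P3ZdAllLettersZd (opsAllZd)
open B9Eq333ProjectionCovarianceZd (isSelfAdjoint_conjR inv_mem_unitaryUnits gaugeAct_inv_gaugeAct)
open B9Eq334GaugeCovarianceZd

-- `Site` alone could resolve to the torus sites of `Setup.lean`; re-export the `ℤ^d` sites of `B7Prop1Explicit`.
export B7Prop1Explicit (Site)

variable {d : ℕ} {𝔸 : Type*} [CStarAlgebra 𝔸]

/-! ## §1  `R(u)` on the Hermitian sub-carrier `E_𝔤(Ω₀)` -/

section Rotation

variable (u : Site d → 𝔸ˣ)

/-- `herm(R(v)a) = R(v)herm(a)` for unitary `v`. [cite: Balaban1985BackgroundPropagators, p.391 («hermitian matrices», bookkeeping)] -/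
theorem hermPart_conjR {v : 𝔸ˣ} (hv : v ∈ unitaryUnits 𝔸) (a : 𝔸) : hermPart (conjR v a) = conjR v (hermPart a) := by
  unfold hermPart
  rw [star_conjR_of_mem_unitaryUnits hv, ← conjR_add, conjR_smul_real]

/-- **`R(u)E_𝔤(Ω₀) ⊂ E_𝔤(Ω₀)`** for unitary `u`. [cite: Balaban1985BackgroundPropagators, (3.28) p.395, p.391] -/
theorem rotB_mem_domSubH (hu : ∀ z, u z ∈ unitaryUnits 𝔸) {Ω₀ : Set (Site d)} {A : Site d → Fin d → 𝔸} (hA : A ∈ domSubH (𝔸 := 𝔸) Ω₀) :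
    rotB u A ∈ domSubH (𝔸 := 𝔸) Ω₀ :=
  ⟨rotB_mem_domSub u hA.1, fun y τ => isSelfAdjoint_conjR (hu y) (hA.2 y τ)⟩

/-- **`R(u)` ON `E_𝔤(Ω₀)`** (restriction of `rotB u`; `u` unitary). [cite: Balaban1985BackgroundPropagators, (3.28), (3.27) p.395, p.391] -/
def rotDH (hu : ∀ z, u z ∈ unitaryUnits 𝔸) (Ω₀ : Set (Site d)) : domSubH (𝔸 := 𝔸) Ω₀ →ₗ[ℝ] domSubH (𝔸 := 𝔸) Ω₀ :=
  (rotB u).restrict fun _ hA => rotB_mem_domSubH u hu hA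

/-- `rotDH`, read back as a bond field. [cite: Balaban1985BackgroundPropagators, (3.28) p.395 (bookkeeping)] -/
theorem coe_rotDH (hu : ∀ z, u z ∈ unitaryUnits 𝔸) (Ω₀ : Set (Site d)) (A : domSubH (𝔸 := 𝔸) Ω₀) :
    (rotDH u hu Ω₀ A : Site d → Fin d → 𝔸) = rotB u (A : Site d → Fin d → 𝔸) := rfl

/-- `R(u⁻¹)R(u) = id` on `E_𝔤(Ω₀)`. [cite: Balaban1985BackgroundPropagators, (3.28) p.395 (bookkeeping)] -/
theorem rotDH_inv_rotDH (hu : ∀ z, u z ∈ unitaryUnits 𝔸) (Ω₀ : Set (Site d)) (A : domSubH (𝔸 := 𝔸) Ω₀) :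
    rotDH u⁻¹ (inv_mem_unitaryUnits hu) Ω₀ (rotDH u hu Ω₀ A) = A :=
  Subtype.ext (rotB_inv_rotB u (A : Site d → Fin d → 𝔸))

/-- `R(u)R(u⁻¹) = id` on `E_𝔤(Ω₀)`. [cite: Balaban1985BackgroundPropagators, (3.28) p.395 (bookkeeping)] -/
theorem rotDH_rotDH_inv (hu : ∀ z, u z ∈ unitaryUnits 𝔸) (Ω₀ : Set (Site d)) (A : domSubH (𝔸 := 𝔸) Ω₀) :
    rotDH u hu Ω₀ (rotDH u⁻¹ (inv_mem_unitaryUnits hu) Ω₀ A) = A :=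
  Subtype.ext (rotB_rotB_inv u (A : Site d → Fin d → 𝔸))

/-- `rotDH u` is a bijection of `E_𝔤(Ω₀)`. [cite: Balaban1985BackgroundPropagators, (3.28) p.395 (bookkeeping)] -/
theorem rotDH_bijective (hu : ∀ z, u z ∈ unitaryUnits 𝔸) (Ω₀ : Set (Site d)) : Function.Bijective (rotDH (𝔸 := 𝔸) u hu Ω₀) :=
  ⟨fun A B h => by rw [← rotDH_inv_rotDH u hu Ω₀ A, ← rotDH_inv_rotDH u hu Ω₀ B, h],
    fun B => ⟨rotDH u⁻¹ (inv_mem_unitaryUnits hu) Ω₀ B, rotDH_rotDH_inv u hu Ω₀ B⟩⟩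

open Classical in
/-- ★ **`herm ∘ 𝟙_{Ω₀}` COMMUTES WITH `R(u)`** (`u` unitary): `restrictLinH Ω₀ (R(u)J) = R(u)(restrictLinH Ω₀ J)`.
[cite: Balaban1985BackgroundPropagators, (3.27) p.395, p.391 (bookkeeping)] -/
theorem restrictLinH_rotB (hu : ∀ z, u z ∈ unitaryUnits 𝔸) (Ω₀ : Set (Site d)) (J : Site d → Fin d → 𝔸) :
    restrictLinH (𝔸 := 𝔸) Ω₀ (rotB u J) = rotDH u hu Ω₀ (restrictLinH Ω₀ J) := by
  apply Subtype.ext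
  rw [coe_rotDH]
  funext y τ
  show (if BondTouches Ω₀ y τ then hermPart (rotB u J y τ) else 0) = rotB u (fun y τ => if BondTouches Ω₀ y τ then hermPart (J y τ) else 0) y τ
  rw [rotB_apply, rotB_apply]
  by_cases h : BondTouches Ω₀ y τ
  · rw [if_pos h, if_pos h, hermPart_conjR (hu y)]
  · rw [if_neg h, if_neg h, conjR_apply, mul_zero, zero_mul]

end Rotation

/-! ## §2  Along the orbit: linearity, Hermiticity-preservation, `RegularAtH`, `G_𝔤`, positivity on `E_𝔤(Ω₀)` -/

section Orbit

variable (η : ℝ) (o : OpsZd d 𝔸) (Ω₀ : Set (Site d)) {u : Site d → 𝔸ˣ} {U₀ : Site d → Fin d → 𝔸ˣ}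

/-- ★ **`LinearOnDomAt` MOVES ALONG THE ORBIT**: if `Δ_a(U₀)` is the restriction of an ℝ-linear `T` on `E(Ω₀)` and `Δ_a` is covariant at `(U₀, u)`, then `Δ_a(U₀^u)`
is the restriction of `R(u)TR(u⁻¹)`. [cite: Balaban1985BackgroundPropagators, (3.34) p.396, (3.26) p.395] -/
theorem linearOnDomAt_gaugeAct (h : LetterCovAt (deltaAOf η o) U₀ u) (hlin : LinearOnDomAt η o Ω₀ U₀) : LinearOnDomAt η o Ω₀ (gaugeAct u U₀) := by
  obtain ⟨T, hT⟩ := hlin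
  refine ⟨(rotB u).comp (T.comp (rotB u⁻¹)), fun A hA => ?_⟩
  rw [LinearMap.comp_apply, LinearMap.comp_apply, hT _ (rotB_mem_domSub u⁻¹ hA), ← h (rotB u⁻¹ A), rotB_rotB_inv]

/-- ★ **`HermPreservingAt` MOVES ALONG THE ORBIT** (`u` unitary): `Δ_a(U₀^u)A = R(u)Δ_a(U₀)(R(u⁻¹)A)` is Hermitian on the bonds of `Ω₀` when `Δ_a(U₀)` preserves
Hermiticity. [cite: Balaban1985BackgroundPropagators, (3.34) p.396, p.391] -/
theorem hermPreservingAt_gaugeAct (hu : ∀ z, u z ∈ unitaryUnits 𝔸) (h : LetterCovAt (deltaAOf η o) U₀ u) (hherm : HermPreservingAt η o Ω₀ U₀) :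
    HermPreservingAt η o Ω₀ (gaugeAct u U₀) := by
  intro A hA y τ hb
  have hA' : rotB u⁻¹ A ∈ domSubH (𝔸 := 𝔸) Ω₀ := rotB_mem_domSubH u⁻¹ (inv_mem_unitaryUnits hu) hA
  have key : deltaAOf η o (gaugeAct u U₀) A = rotB u (deltaAOf η o U₀ (rotB u⁻¹ A)) := by
    rw [← h (rotB u⁻¹ A), rotB_rotB_inv]
  rw [key, rotB_apply]
  exact isSelfAdjoint_conjR (hu y) (hherm _ hA' y τ hb)

/-- ★ **`RegularAtH` MOVES ALONG THE ORBIT** (`u` unitary): conjugate the invertible operator of `E_𝔤(Ω₀)` by `R(u)`. [cite: Balaban1985BackgroundPropagators, (3.34) p.396, Thm 3.11 p.416, (3.35)–(3.36) p.396] -/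
theorem regularAtH_gaugeAct (hu : ∀ z, u z ∈ unitaryUnits 𝔸) (h : LetterCovAt (deltaAOf η o) U₀ u) (hr : RegularAtH η o Ω₀ U₀) :
    RegularAtH η o Ω₀ (gaugeAct u U₀) := by
  obtain ⟨Φ, hΦ, hbij⟩ := hr
  refine ⟨(rotDH u hu Ω₀).comp (Φ.comp (rotDH u⁻¹ (inv_mem_unitaryUnits hu) Ω₀)), fun A => ?_, ?_⟩
  · rw [LinearMap.comp_apply, LinearMap.comp_apply, coe_rotDH, hΦ, coe_rotDH, ← deltaADom_gaugeAct η o Ω₀ h, rotB_rotB_inv]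
  · exact (rotDH_bijective u hu Ω₀).comp (hbij.comp (rotDH_bijective u⁻¹ (inv_mem_unitaryUnits hu) Ω₀))

/-- `RegularAtH` is CONSTANT on the orbit (covariance at `(U₀, u)` and `(U₀^u, u⁻¹)`). [cite: Balaban1985BackgroundPropagators, (3.34) p.396, Thm 3.11 p.416] -/
theorem regularAtH_gaugeAct_iff (hu : ∀ z, u z ∈ unitaryUnits 𝔸) (h : LetterCovAt (deltaAOf η o) U₀ u)
    (h' : LetterCovAt (deltaAOf η o) (gaugeAct u U₀) u⁻¹) : RegularAtH η o Ω₀ (gaugeAct u U₀) ↔ RegularAtH η o Ω₀ U₀ := by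
  refine ⟨fun hr => ?_, regularAtH_gaugeAct η o Ω₀ hu h⟩
  have h1 := regularAtH_gaugeAct η o Ω₀ (inv_mem_unitaryUnits hu) h' hr
  rwa [gaugeAct_inv_gaugeAct] at h1

/-- ★★★ **(3.34) ON `E_𝔤(Ω₀)`: `G_𝔤(U₀^u)(R(u)J) = R(u)(G_𝔤(U₀)J)`** for dag-n06-b's `gopZdH η o Ω₀` over ANY record whose `Δ_a` is covariant at `(U₀, u)` and
`(U₀^u, u⁻¹)` (`u` unitary): in the regime by uniqueness of the inverse on `E_𝔤(Ω₀)` (`herm∘𝟙_{Ω₀}` commutes with `R(u)`), outside it both sides are `0`.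
[cite: Balaban1985BackgroundPropagators, (3.34) p.396, (3.27) p.395] -/
theorem gopZdH_gaugeAct (hu : ∀ z, u z ∈ unitaryUnits 𝔸) (h : LetterCovAt (deltaAOf η o) U₀ u) (h' : LetterCovAt (deltaAOf η o) (gaugeAct u U₀) u⁻¹)
    (J : Site d → Fin d → 𝔸) : gopZdH η o Ω₀ (gaugeAct u U₀) (rotB u J) = rotB u (gopZdH η o Ω₀ U₀ J) := by
  by_cases hr : RegularAtH η o Ω₀ U₀
  · have hr' : RegularAtH η o Ω₀ (gaugeAct u U₀) := regularAtH_gaugeAct η o Ω₀ hu h hr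
    rw [gopZdH_of_regularAtH η o Ω₀ _ hr', gopZdH_of_regularAtH η o Ω₀ _ hr]
    set B := (deltaAEquivH η o Ω₀ U₀ hr).symm (restrictLinH Ω₀ J) with hB
    have hB' : deltaAEquivH η o Ω₀ U₀ hr B = restrictLinH Ω₀ J := by rw [hB, LinearEquiv.apply_symm_apply]
    have hsol : deltaAEquivH η o Ω₀ (gaugeAct u U₀) hr' (rotDH u hu Ω₀ B) = restrictLinH Ω₀ (rotB u J) := by
      apply Subtype.ext
      rw [deltaAEquivH_coe, coe_rotDH, deltaADom_gaugeAct η o Ω₀ h, restrictLinH_rotB u hu, coe_rotDH]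
      have hc := congrArg (fun C : domSubH (𝔸 := 𝔸) Ω₀ => (C : Site d → Fin d → 𝔸)) hB'
      simp only [deltaAEquivH_coe] at hc
      rw [hc]
    have hs : (deltaAEquivH η o Ω₀ (gaugeAct u U₀) hr').symm (restrictLinH Ω₀ (rotB u J)) = rotDH u hu Ω₀ B := by
      rw [LinearEquiv.symm_apply_eq]
      exact hsol.symm
    rw [hs, coe_rotDH]
  · have hr' : ¬ RegularAtH η o Ω₀ (gaugeAct u U₀) := fun h1 => hr ((regularAtH_gaugeAct_iff η o Ω₀ hu h h').1 h1)
    rw [gopZdH_of_not_regularAtH η o Ω₀ _ hr', gopZdH_of_not_regularAtH η o Ω₀ _ hr, map_zero]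

/-- ★★ **POSITIVE-DEFINITENESS OF `Δ_a` ON `E_𝔤(Ω₀)` PASSES ALONG THE ORBIT** (`u` unitary, `τ` tracial, `Δ_a` covariant at `(U₀, u)`).
[cite: Balaban1985BackgroundPropagators, Thm 3.11 p.416, (3.34)–(3.36) p.396] -/
theorem posDefH_gaugeAct (τ : 𝔸 →ₗ[ℂ] ℂ) (hτt : ∀ a b : 𝔸, τ (a * b) = τ (b * a)) (hu : ∀ z, u z ∈ unitaryUnits 𝔸)
    (h : LetterCovAt (deltaAOf η o) U₀ u) (hpos : ∀ A ∈ domSubH (𝔸 := 𝔸) Ω₀, A ≠ 0 → 0 < bondPair τ A (deltaAOf η o U₀ A)) :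
    ∀ A ∈ domSubH (𝔸 := 𝔸) Ω₀, A ≠ 0 → 0 < bondPair τ A (deltaAOf η o (gaugeAct u U₀) A) := by
  intro A hA hA0
  have hA' : rotB u⁻¹ A ∈ domSubH (𝔸 := 𝔸) Ω₀ := rotB_mem_domSubH u⁻¹ (inv_mem_unitaryUnits hu) hA
  have hA0' : rotB u⁻¹ A ≠ 0 := fun h0 => hA0 (by rw [← rotB_rotB_inv u A, h0, map_zero])
  have key := bondPair_deltaAOf_gaugeAct η o τ hτt hu h (rotB u⁻¹ A)
  rw [rotB_rotB_inv] at key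
  rw [key]
  exact hpos _ hA' hA0'

end Orbit

/-! ## §3  The genuine four-letter record at a member with finite `Ω₀` -/

section Record

variable [FiniteDimensional ℝ 𝔸] [Nontrivial 𝔸] (τ : 𝔸 →ₗ[ℂ] ℂ) (L : ℕ) (ΛbP : ℕ → ℕ → Set (Site d × Fin d))
  (ops₀ : ℝ → ZdIdx d L → ℕ → OpsZd d 𝔸) (M : ℝ) (i : ZdIdx d L) (m : ℕ) {u : Site d → 𝔸ˣ} {U₀ : Site d → Fin d → 𝔸ˣ}
  (hL : 2 ≤ L) (hbox : ∀ j, 1 ≤ j → j ≤ m → ∀ c ∈ ΛbP m j, ∀ x, InBox (loK L j c.1) (bondHiK L j c.1 c.2) x → x ∈ i.Ω (j - 1))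
  (hτt : ∀ a b : 𝔸, τ (a * b) = τ (b * a)) (hτs : ∀ a : 𝔸, τ (star a) = starRingEnd ℂ (τ a)) (hτp : ∀ a : 𝔸, a ≠ 0 → 0 < (τ (star a * a)).re)
  (hU₀ : ∀ x κ, U₀ x κ ∈ unitaryUnits 𝔸) (hu : ∀ z, u z ∈ unitaryUnits 𝔸) (hΩ : (i.Ω 0).Finite)
include hL hbox hτt hτs hτp hU₀ hu hΩ

/-- `LinearOnDomAt` of the genuine `Δ_a` passes from `U₀` to `U₀^u`. [cite: Balaban1985BackgroundPropagators, (3.34) p.396, (3.26) p.395] -/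
theorem linearOnDomAt_opsAllZd_gaugeAct (hlin : LinearOnDomAt i.η (opsAllZd τ L ΛbP ops₀ M i m) (i.Ω 0) U₀) :
    LinearOnDomAt i.η (opsAllZd τ L ΛbP ops₀ M i m) (i.Ω 0) (gaugeAct u U₀) :=
  linearOnDomAt_gaugeAct i.η _ (i.Ω 0) (letterCovAt_deltaAOf_opsAllZd τ L ΛbP ops₀ M i m hL hbox hτt hτs hτp hU₀ hu hΩ) hlin

/-- `HermPreservingAt` of the genuine `Δ_a` passes from `U₀` to `U₀^u`. [cite: Balaban1985BackgroundPropagators, (3.34) p.396, p.391] -/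
theorem hermPreservingAt_opsAllZd_gaugeAct (hherm : HermPreservingAt i.η (opsAllZd τ L ΛbP ops₀ M i m) (i.Ω 0) U₀) :
    HermPreservingAt i.η (opsAllZd τ L ΛbP ops₀ M i m) (i.Ω 0) (gaugeAct u U₀) :=
  hermPreservingAt_gaugeAct i.η _ (i.Ω 0) hu (letterCovAt_deltaAOf_opsAllZd τ L ΛbP ops₀ M i m hL hbox hτt hτs hτp hU₀ hu hΩ) hherm

/-- `RegularAtH` for the genuine record is constant on the orbit. [cite: Balaban1985BackgroundPropagators, (3.34) p.396, Thm 3.11 p.416] -/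
theorem regularAtH_opsAllZd_gaugeAct_iff :
    RegularAtH i.η (opsLandau τ (withDpZd (withQQP τ L ΛbP ops₀)) M i m) (i.Ω 0) (gaugeAct u U₀) ↔
      RegularAtH i.η (opsLandau τ (withDpZd (withQQP τ L ΛbP ops₀)) M i m) (i.Ω 0) U₀ :=
  regularAtH_gaugeAct_iff i.η _ (i.Ω 0) hu (letterCovAt_deltaAOf_opsAllZd τ L ΛbP ops₀ M i m hL hbox hτt hτs hτp hU₀ hu hΩ)
    (letterCovAt_deltaAOf_opsAllZd τ L ΛbP ops₀ M i m (u := u⁻¹) (U₀ := gaugeAct u U₀) hL hbox hτt hτs hτp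
      (gaugeAct_mem_unitaryUnits' hU₀ hu) (inv_mem_unitaryUnits hu) hΩ)

/-- ★★★ **(3.34) ON `E_𝔤(Ω₀)` FOR THE GENUINE RECORD**: `G_𝔤(U₀^u)(R(u)J) = R(u)(G_𝔤(U₀)J)` for `gopZdH i.η (opsLandau τ (withDpZd (withQQP τ L ΛbP ops₀)) M i m) (i.Ω 0)`
(the three genuine co-letters of `opsAllZd`), every bond field `J`. [cite: Balaban1985BackgroundPropagators, (3.34) p.396, (3.27) p.395] -/
theorem gopZdH_opsAllZd_gaugeAct (J : Site d → Fin d → 𝔸) :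
    gopZdH i.η (opsLandau τ (withDpZd (withQQP τ L ΛbP ops₀)) M i m) (i.Ω 0) (gaugeAct u U₀) (rotB u J) =
      rotB u (gopZdH i.η (opsLandau τ (withDpZd (withQQP τ L ΛbP ops₀)) M i m) (i.Ω 0) U₀ J) :=
  gopZdH_gaugeAct i.η _ (i.Ω 0) hu (letterCovAt_deltaAOf_opsAllZd τ L ΛbP ops₀ M i m hL hbox hτt hτs hτp hU₀ hu hΩ)
    (letterCovAt_deltaAOf_opsAllZd τ L ΛbP ops₀ M i m (u := u⁻¹) (U₀ := gaugeAct u U₀) hL hbox hτt hτs hτp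
      (gaugeAct_mem_unitaryUnits' hU₀ hu) (inv_mem_unitaryUnits hu) hΩ) J

/-- ★★ **POSITIVITY OF THE GENUINE `Δ_a` ON `E_𝔤(Ω₀)` PASSES FROM `U₀` TO `U₀^u`** — with `flat_posDef_herm_cube` (n06-b) and `B9Thm311PosDefOpenZd` (n06-w4 g3):
positivity on a neighbourhood of every pure gauge `1^u`. [cite: Balaban1985BackgroundPropagators, Thm 3.11 p.416, (3.34)–(3.36) p.396] -/
theorem posDefH_opsAllZd_gaugeAct
    (hpos : ∀ A ∈ domSubH (𝔸 := 𝔸) (i.Ω 0), A ≠ 0 → 0 < bondPair τ A (deltaAOf i.η (opsAllZd τ L ΛbP ops₀ M i m) U₀ A)) :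
    ∀ A ∈ domSubH (𝔸 := 𝔸) (i.Ω 0), A ≠ 0 → 0 < bondPair τ A (deltaAOf i.η (opsAllZd τ L ΛbP ops₀ M i m) (gaugeAct u U₀) A) :=
  posDefH_gaugeAct i.η _ (i.Ω 0) τ hτt hu (letterCovAt_deltaAOf_opsAllZd τ L ΛbP ops₀ M i m hL hbox hτt hτs hτp hU₀ hu hΩ) hpos

end Record

/-! ## §4  The same for `U₀` in the class (1.7) on all of `ℤᵈ` (NO box clause — the regime set of the per-member road, classes with crossing bonds) -/

section RecordUniv

variable [FiniteDimensional ℝ 𝔸] [Nontrivial 𝔸] (τ : 𝔸 →ₗ[ℂ] ℂ) (L : ℕ) (ΛbP : ℕ → ℕ → Set (Site d × Fin d))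
  (ops₀ : ℝ → ZdIdx d L → ℕ → OpsZd d 𝔸) (M : ℝ) (i : ZdIdx d L) (m : ℕ) {u : Site d → 𝔸ˣ} {U₀ : Site d → Fin d → 𝔸ˣ}
  (hL : 2 ≤ L) (hτt : ∀ a b : 𝔸, τ (a * b) = τ (b * a)) (hτs : ∀ a : 𝔸, τ (star a) = starRingEnd ℂ (τ a)) (hτp : ∀ a : 𝔸, a ≠ 0 → 0 < (τ (star a * a)).re)
  (hU₀ : ∀ x κ, U₀ x κ ∈ unitaryUnits 𝔸)
  (hregU : B9Eq316AveragingTransposeZd.Reg17 L m (fun _ => (Set.univ : Set (Site d))) (B9Eq316AveragingTransposeZd.alphaQ d L / (L : ℝ) ^ 2) U₀)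
  (hu : ∀ z, u z ∈ unitaryUnits 𝔸) (hΩ : (i.Ω 0).Finite)
include hL hτt hτs hτp hU₀ hregU hu hΩ

/-- `LinearOnDomAt` of the genuine `Δ_a` passes from `U₀` to `U₀^u` — `U₀` in the class (1.7) on `ℤᵈ`, ANY averaging class `ΛbP` (crossing bonds allowed).
[cite: Balaban1985BackgroundPropagators, (3.34) p.396, (3.26) p.395; Balaban1985RegularSpaces, (1.7) p.77] -/
theorem linearOnDomAt_opsAllZd_gaugeAct_of_reg17Univ (hlin : LinearOnDomAt i.η (opsAllZd τ L ΛbP ops₀ M i m) (i.Ω 0) U₀) :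
    LinearOnDomAt i.η (opsAllZd τ L ΛbP ops₀ M i m) (i.Ω 0) (gaugeAct u U₀) :=
  linearOnDomAt_gaugeAct i.η _ (i.Ω 0) (letterCovAt_deltaAOf_opsAllZd_of_reg17Univ τ L ΛbP ops₀ M i m hL hτt hτs hτp hU₀ hregU hu hΩ) hlin

/-- `HermPreservingAt` of the genuine `Δ_a` passes from `U₀` to `U₀^u` — `U₀` in the class (1.7) on `ℤᵈ`, any class.
[cite: Balaban1985BackgroundPropagators, (3.34) p.396, p.391; Balaban1985RegularSpaces, (1.7) p.77] -/
theorem hermPreservingAt_opsAllZd_gaugeAct_of_reg17Univ (hherm : HermPreservingAt i.η (opsAllZd τ L ΛbP ops₀ M i m) (i.Ω 0) U₀) :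
    HermPreservingAt i.η (opsAllZd τ L ΛbP ops₀ M i m) (i.Ω 0) (gaugeAct u U₀) :=
  hermPreservingAt_gaugeAct i.η _ (i.Ω 0) hu (letterCovAt_deltaAOf_opsAllZd_of_reg17Univ τ L ΛbP ops₀ M i m hL hτt hτs hτp hU₀ hregU hu hΩ) hherm

/-- ★★ positivity of the genuine `Δ_a` on `E_𝔤(Ω₀)` passes from `U₀` to `U₀^u` — `U₀` in the class (1.7) on `ℤᵈ`, any class (the currency of
`B9Thm311PosDefOpenZd.bondPair_pos_eventually_one_cube`, class `cubeLamBP`). [cite: Balaban1985BackgroundPropagators, Thm 3.11 p.416, (3.34)–(3.36) p.396] -/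
theorem posDefH_opsAllZd_gaugeAct_of_reg17Univ
    (hpos : ∀ A ∈ domSubH (𝔸 := 𝔸) (i.Ω 0), A ≠ 0 → 0 < bondPair τ A (deltaAOf i.η (opsAllZd τ L ΛbP ops₀ M i m) U₀ A)) :
    ∀ A ∈ domSubH (𝔸 := 𝔸) (i.Ω 0), A ≠ 0 → 0 < bondPair τ A (deltaAOf i.η (opsAllZd τ L ΛbP ops₀ M i m) (gaugeAct u U₀) A) :=
  posDefH_gaugeAct i.η _ (i.Ω 0) τ hτt hu (letterCovAt_deltaAOf_opsAllZd_of_reg17Univ τ L ΛbP ops₀ M i m hL hτt hτs hτp hU₀ hregU hu hΩ) hpos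

end RecordUniv

end Literature.MathematicalPhysics.QuantumFieldTheory.Balaban1983to89.B9Eq334GaugeCovarianceZdHerm

end
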